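import Summits.QuantumFields.YangMills.Theorems.WeakCouplingRatesColdBoxRepresentation
import Summits.QuantumFields.YangMills.Theorems.WeakCouplingRatesColdBoxTiltBound
import Summits.QuantumFields.YangMills.Theorems.WeakCouplingRatesBulkDominatesColdBoxWDefs
import Summits.QuantumFields.YangMills.Theorems.WeakCouplingRatesBulkDominatesColdBoxWDatumCompetitorEventually
import Summits.QuantumFields.YangMills.Theorems.WeakCouplingRatesColdBoxDirichletShiftPi
import Summits.QuantumFields.YangMills.Theorems.WeakCouplingRatesColdBoxDirichletShiftedCov
import Summits.QuantumFields.YangMills.Theorems.WeakCouplingRatesBulkDominatesColdBoxWKernelCongrCollar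
import Summits.QuantumFields.YangMills.Theorems.WeakCouplingRatesBulkDominatesColdBoxWKernelGauge
import Summits.QuantumFields.YangMills.Theorems.WeakCouplingRatesBulkDominatesColdBoxWCrudeGoodLargeField

/-! Stub-critic sketch rev 2 (ym-scrit-goodBoundaryCovStable g2, 2026-08-27): the ϑ-DATUM versions of the one-scale objects of
`…ColdBoxOneScaleDefs` and the two TRUNK TARGET statements (representation with datum, tilt bound with datum) that the 19609 read-outs
`stub_kernelCovExpansion` / `stub_kernelMeanExpansion` consume, plus the two small new identities (circulation split, Maxwell-form split).
Signatures only (sorried) — proposals for ★ym-wcr-19456-p1 g2's ϑ-pass; names may change.  Not claims. -/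

set_option autoImplicit false

noncomputable section

open MeasureTheory ProbabilityTheory Finset Matrix Real
open scoped ENNReal
open Literature.Probability.LatticeModels
open Literature.MathematicalPhysics.QuantumLattice
open Literature.MathematicalPhysics.QuantumFieldTheory
open Literature.MathematicalPhysics.QuantumFieldTheory.LatticeMaxwell
open Literature.MathematicalPhysics.QuantumFieldTheory.AxialGauge

namespace Summit.QuantumFields.YangMills.Theorems.WeakCouplingRates.CriticSketch2

variable {H : ℕ}

/-! ## T1 — objects with datum (`ϑ = 0` gives back g2's flat objects definitionally up to `mean 0 = 0`) -/

/-- Free-link data `w` extended by the exterior chart datum `ϑ` off the cold box and by `0` on the temporal forest. -/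
def extDatum {V : Type*} [Zero V] (ϑ : Literature.MathematicalPhysics.QuantumLattice.ZdEdge 4 → V) (w : ColdFreeIdx H → V) :
    Literature.MathematicalPhysics.QuantumLattice.ZdEdge 4 → V := fun e =>
  if h : e ∈ boxEdges 4 (2 * H + 1) then
    (if hf : (e.2 = 0 ∧ ∀ k : Fin 4, 1 ≤ e.1 k ∧ e.1 k + 1 ≤ 2 * (H : ℤ)) then 0 else w ⟨⟨e, h⟩, hf⟩)
  else ϑ e

theorem extDatum_zero {V : Type*} [Zero V] (w : ColdFreeIdx H → V) : extDatum (H := H) 0 w = extZero w := by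
  funext e; simp only [extDatum, extZero, Pi.zero_apply]

@[simp] theorem extDatum_apply_free {V : Type*} [Zero V] (ϑ : Literature.MathematicalPhysics.QuantumLattice.ZdEdge 4 → V)
    (w : ColdFreeIdx H → V) (e : ColdFreeIdx H) : extDatum ϑ w e.1.1 = w e := by
  obtain ⟨⟨e, he⟩, hf⟩ := e
  unfold extDatum
  rw [dif_pos he, dif_neg hf]

theorem extDatum_of_not_mem {V : Type*} [Zero V] (ϑ : Literature.MathematicalPhysics.QuantumLattice.ZdEdge 4 → V)
    (w : ColdFreeIdx H → V) {e : Literature.MathematicalPhysics.QuantumLattice.ZdEdge 4} (he : e ∉ boxEdges 4 (2 * H + 1)) :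
    extDatum ϑ w e = ϑ e := by
  simp [extDatum, he]

/-- The scaled datum `ϑ' = √(2β)·ϑ` (Dirichlet units), colour by colour. -/
def sdat (β : ℝ) (ϑ : Fin 3 → (Literature.MathematicalPhysics.QuantumLattice.ZdEdge 4 → ℝ)) :
    Fin 3 → (Literature.MathematicalPhysics.QuantumLattice.ZdEdge 4 → ℝ) := fun c => Real.sqrt (2 * β) • ϑ c

variable (H) in
/-- The harmonic MEAN SHIFT of the scaled datum as a colour triple of D1′ variables: `(mean ϑ'_c)_c`. -/
def meanT (β : ℝ) (ϑ : Fin 3 → (Literature.MathematicalPhysics.QuantumLattice.ZdEdge 4 → ℝ)) : TSpace H :=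
  fun c => WithLp.toLp 2 (mean (fun e => e ∉ dirFreeEdges H) dirCorner (2 * H + 3) (sdat β ϑ c))

variable (H) in
/-- **Chart configuration with datum** of the (unshifted, centred) colour triple `t`: free links `P(1, (t + μ')_e/√(2β))`, forest links `1`,
exterior links `P(1, ϑ_e)`.  At `ϑ = 0` this is `cfgT H β t`. -/
def cfgTD (β : ℝ) (ϑ : Fin 3 → (Literature.MathematicalPhysics.QuantumLattice.ZdEdge 4 → ℝ)) (t : TSpace H) :
    LGConfig 4 (Matrix.specialUnitaryGroup (Fin 2) ℂ) :=
  fun e => gnomonicChart (extDatum (fun e c => ϑ c e) (unscaleT H β (t + meanT H β ϑ)) e)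

variable (H) in
/-- **Quadratic surrogate with datum** of `β·cost_p`: `½ Σ_c (sCirc (glue ϑ'_c (mean ϑ'_c + t_c)) p)²` — literally the observable of
`cov_quadObs_datum_eq` / `integral_quadObs_datum_eq` (g3) at the scaled datum. -/
def qObsD (β : ℝ) (ϑ : Fin 3 → (Literature.MathematicalPhysics.QuantumLattice.ZdEdge 4 → ℝ)) (p : Plaq 4) (t : TSpace H) : ℝ :=
  1 / 2 * ∑ c, (sCirc (glue (pin := fun e => e ∉ dirFreeEdges H) dirCorner (2 * H + 3) (sdat β ϑ c)
    (mean (fun e => e ∉ dirFreeEdges H) dirCorner (2 * H + 3) (sdat β ϑ c) + WithLp.ofLp (t c))) p) ^ 2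

variable (H) in
/-- The small-field event read in the centred colour variables, with datum. -/
def goodTD (β ε : ℝ) (ϑ : Fin 3 → (Literature.MathematicalPhysics.QuantumLattice.ZdEdge 4 → ℝ)) : Set (TSpace H) :=
  {t | cfgTD H β ϑ t ∈ coldGoodSet β ε H}

variable (H) in
/-- **Tilt exponent with datum**: cubic remainder over the touching plaquettes + gnomonic log-Jacobian over the FREE links only. -/
def tiltWD (β : ℝ) (ϑ : Fin 3 → (Literature.MathematicalPhysics.QuantumLattice.ZdEdge 4 → ℝ)) (t : TSpace H) : ℝ :=
  (∑ q ∈ plaquettesTouching (boxEdges 4 (2 * H + 1)),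
      (qObsD H β ϑ (q.1, q.2.1.1, q.2.1.2) t - β * plaqCostAt (fundamentalRep (Fin 2)) q.1 q.2.1.1 q.2.1.2 (cfgTD H β ϑ t))) +
    ∑ e : ColdFreeIdx H, Real.log (((1 + ∑ i, (unscaleT H β (t + meanT H β ϑ) e i) ^ 2)⁻¹) ^ 2)

/-! ## T2 — the two small NEW identities of the ϑ-pass -/

/-- **Circulation split** (affine): on a plaquette all of whose edges lie in the enlarged block, the chart circulation of `cfgTD` is
`(background + fluctuation)/√(2β)`: `√(2β)·sCirc(extDatum ϑ ((t+μ')/√(2β)))_c (p) = sCirc (glue ϑ'_c (mean ϑ'_c + t_c)) p`.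
Needs `ϑ = 0` on the forest (pinned there by `glue`, `0` there in `extDatum`). [`sCirc_glue_add_ofLp`, `extZero_unscaleT`] -/
theorem sqrt_mul_sCirc_extDatum_eq {β : ℝ} (hβ : 0 < β) (ϑ : Fin 3 → (Literature.MathematicalPhysics.QuantumLattice.ZdEdge 4 → ℝ))
    (hforest : ∀ x : Site 4, (∀ k : Fin 4, 1 ≤ x k ∧ x k + 1 ≤ 2 * (H : ℤ)) → ∀ c, ϑ c (x, 0) = 0)
    (t : TSpace H) (c : Fin 3) {p : Plaq 4}
    (hp : (p.1, p.2.1) ∈ boxEdgesAt dirCorner (2 * H + 3) ∧ (p.1 + Pi.single p.2.1 1, p.2.2) ∈ boxEdgesAt dirCorner (2 * H + 3) ∧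
      (p.1 + Pi.single p.2.2 1, p.2.1) ∈ boxEdgesAt dirCorner (2 * H + 3) ∧ (p.1, p.2.2) ∈ boxEdgesAt dirCorner (2 * H + 3)) :
    Real.sqrt (2 * β) * sCirc (fun e => extDatum (fun e c => ϑ c e) (unscaleT H β (t + meanT H β ϑ)) e c) p =
      sCirc (glue (pin := fun e => e ∉ dirFreeEdges H) dirCorner (2 * H + 3) (sdat β ϑ c)
        (mean (fun e => e ∉ dirFreeEdges H) dirCorner (2 * H + 3) (sdat β ϑ c) + WithLp.ofLp (t c))) p := by
  sorry

/-- **Maxwell-form split with datum**: `M_ϑ(s) − Σ_{q touching Λ} sCirc(glue ϑ s)(q)²` does not depend on `s` (the plaquettes of the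
enlarged block NOT touching `Λ` have only pinned edges; at `ϑ = 0` the constant is `0`: `formM_dir_eq_sum_touching`).  The constant cancels in
every normalised expectation and is swallowed by the energy UPPER bound. -/
theorem formM_sub_sum_touching_eq (θ : Literature.MathematicalPhysics.QuantumLattice.ZdEdge 4 → ℝ) (s s' : DirFree H → ℝ) :
    formM (fun e => e ∉ dirFreeEdges H) dirCorner (2 * H + 3) θ s -
        ∑ q ∈ plaquettesTouching (boxEdges 4 (2 * H + 1)),
          (sCirc (glue (pin := fun e => e ∉ dirFreeEdges H) dirCorner (2 * H + 3) θ s) (q.1, q.2.1.1, q.2.1.2)) ^ 2 =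
      formM (fun e => e ∉ dirFreeEdges H) dirCorner (2 * H + 3) θ s' -
        ∑ q ∈ plaquettesTouching (boxEdges 4 (2 * H + 1)),
          (sCirc (glue (pin := fun e => e ∉ dirFreeEdges H) dirCorner (2 * H + 3) θ s') (q.1, q.2.1.1, q.2.1.2)) ^ 2 := by
  sorry

/-! ## T3 — REPRESENTATION WITH DATUM (the ϑ-twin of `integral_cond_boxState_eq_integral_tilted`) -/

/-- **Representation with datum.**  For a datum `W` whose exterior links on the enlarged block are chart points `P(1, ϑ_e)` with
`Σ_c ϑ_{c,e}² ≤ r²`, `ϑ = 0` on the temporal forest, inside the link-smallness window, and for every measurable gauge-invariant `X ≥ 0`: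
the kernel `γ_Λ(·|W)` conditioned on the small-field event is the `e^{tiltWD}`-tilt of the conditioned, UNshifted product Dirichlet Gaussian
read through `cfgTD` (the mean shift `μ' = mean ϑ'` sits inside `cfgTD`).  Chain = the flat chain with `integral_ymSpecification_box_eq_coldFree`
(datum forest gauge, M1) for `integral_boxState_eq_coldFree`, the Poincaré ladder with exterior radius `r` (M2) for R1, and
`lintegral_pi_mul_prod_wθ_dir_div_eq` (R4c) after completing the square colour by colour (`formM_sub_sum_touching_eq`, `formM_smul`). -/
theorem integral_cond_boxKernel_eq_integral_tilted_datum {β ε r : ℝ} (hβ : 0 < β) (hH : 1 ≤ H) (hr : 0 ≤ r)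
    (hη : Real.sqrt 2 * ((12 * (H : ℝ) ^ 2 + 2 * H + 1) * (Real.sqrt (2 * β ^ (2 * ε - 1)) + 4 * r)) ≤ 1 / 4)
    {W : LGConfig 4 (Matrix.specialUnitaryGroup (Fin 2) ℂ)} {ϑ : Fin 3 → (Literature.MathematicalPhysics.QuantumLattice.ZdEdge 4 → ℝ)}
    (hW : ∀ e ∈ boxEdgesAt dirCorner (2 * H + 3), e ∉ boxEdges 4 (2 * H + 1) → W e = gnomonicChart (fun c => ϑ c e))
    (hϑ : ∀ e ∈ boxEdgesAt dirCorner (2 * H + 3), e ∉ boxEdges 4 (2 * H + 1) → ∑ c, ϑ c e ^ 2 ≤ r ^ 2)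
    (hforest : ∀ x : Site 4, (∀ k : Fin 4, 1 ≤ x k ∧ x k + 1 ≤ 2 * (H : ℤ)) → ∀ c, ϑ c (x, 0) = 0)
    (hG0 : boxKernel β H W (coldGoodSet β ε H) ≠ 0) (hγ : gauss3 H (goodTD H β ε ϑ) ≠ 0)
    {X : LGConfig 4 (Matrix.specialUnitaryGroup (Fin 2) ℂ) → ℝ} (hXm : Measurable X) (hXinv : IsZdGaugeInvariant X)
    (hX0 : ∀ U, 0 ≤ X U) :
    ∫ U, X U ∂((boxKernel β H W)[|coldGoodSet β ε H]) =
      ∫ t, X (cfgTD H β ϑ t) ∂(((gauss3 H)[|goodTD H β ε ϑ]).tilted ((goodTD H β ε ϑ).indicator (tiltWD H β ϑ))) := by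
  sorry

/-! ## T4 — TILT BOUND WITH DATUM (the ϑ-twin of `abs_tiltW_le_of_mem_goodT`; `m` now carries the exterior radius `4r`) -/

theorem abs_tiltWD_le_of_mem_goodTD {β ε r : ℝ} (hβ : 0 < β) (hH : 1 ≤ H) (hr : 0 ≤ r)
    (hm : Real.sqrt 2 * ((12 * (H : ℝ) ^ 2 + 2 * H + 1) * (Real.sqrt (2 * β ^ (2 * ε - 1)) + 4 * r)) ≤ 1 / 4)
    {ϑ : Fin 3 → (Literature.MathematicalPhysics.QuantumLattice.ZdEdge 4 → ℝ)}
    (hϑ : ∀ e ∈ boxEdgesAt dirCorner (2 * H + 3), e ∉ boxEdges 4 (2 * H + 1) → ∑ c, ϑ c e ^ 2 ≤ r ^ 2)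
    (hforest : ∀ x : Site 4, (∀ k : Fin 4, 1 ≤ x k ∧ x k + 1 ≤ 2 * (H : ℤ)) → ∀ c, ϑ c (x, 0) = 0)
    {t : TSpace H} (ht : t ∈ goodTD H β ε ϑ) :
    |tiltWD H β ϑ t| ≤
      (#(plaquettesTouching (boxEdges 4 (2 * H + 1))) : ℝ) *
          (362 * β * (Real.sqrt 2 * ((12 * (H : ℝ) ^ 2 + 2 * H + 1) * (Real.sqrt (2 * β ^ (2 * ε - 1)) + 4 * r))) ^ 3) +
        2 * (Fintype.card (ColdFreeIdx H) : ℝ) *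
          (Real.sqrt 2 * ((12 * (H : ℝ) ^ 2 + 2 * H + 1) * (Real.sqrt (2 * β ^ (2 * ε - 1)) + 4 * r))) ^ 2 := by
  sorry

/-! ## T5 — the KERNEL BRIDGE used by the 19609 assembler: `γ(·|ω)`-expectations of gauge-invariant collar-local observables equal those of
`γ(·|W)`, `W` = the truncated gauge copy of `…DatumCompetitor` (three landed lemmas: `…KernelGauge`, `…KernelCongrCollar`,
`ymSpecification_congr_exterior`).  Stated for the shape the assembler needs (the plaquette costs AND the bad-event indicator). -/

theorem integral_boxKernel_eq_of_gauge_trunc (β : ℝ) (H : ℕ) (ω : LGConfig 4 (Matrix.specialUnitaryGroup (Fin 2) ℂ))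
    (g : Site 4 → Matrix.specialUnitaryGroup (Fin 2) ℂ)
    {X : LGConfig 4 (Matrix.specialUnitaryGroup (Fin 2) ℂ) → ℝ} (hXm : Measurable X) (hXinv : IsZdGaugeInvariant X)
    (hXloc : ∀ U U' : LGConfig 4 (Matrix.specialUnitaryGroup (Fin 2) ℂ),
      (∀ e ∈ boxEdgesAt dirCorner (2 * H + 3), U e = U' e) → X U = X U') :
    ∫ U, X U ∂(boxKernel β H ω) =
      ∫ U, X U ∂(boxKernel β H
        (forestFix H (glueWith (boxEdgesAt dirCorner (2 * H + 3))
          (fun e' : ↥(boxEdgesAt dirCorner (2 * H + 3)) => gaugeTransformZd g ω e'.1) (fun _ => 1)))) := by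
  sorry

end Summit.QuantumFields.YangMills.Theorems.WeakCouplingRates.CriticSketch2

end
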